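import Summits.Langlands.Langlands.Theses.PhantomRMYoshida
import Literature.NumberTheory.Automorphic.NewformAdelisationArchCovariance
import Literature.NumberTheory.Automorphic.CuspidalRepDataOfCuspForm
import Literature.NumberTheory.Automorphic.SerreConjectureProofs
import Literature.NumberTheory.GaloisRepresentations.SerreWeightLowerBoundProofs
import Literature.NumberTheory.EllipticCurves.NewformGaloisRep

/-!
# Line `lowest-weight-casimir-dictionary` — skeleton for crux `PhantomRMYoshida.SerreKWAutomorphicGL2`
# (stmt-Langlands-12944, route-Langlands-PhantomRMYoshida; crux-plan, round 1; skeleton v2, gen-2 planner)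

**Idea** (crux-idea card `lowest-weight-casimir-dictionary`, ideator 2; triage r1: pass ×3, merged with
`cyclic-bj-datum-adelic-newform` / `adelic-newform-datum-double-twist` on the automorphic half and with
`residue-adapted-embedding-conjugate-eigensystem` / `clozel-conjugation-alignment` on the alignment half;
the panel's recommended composite).  The crux is Serre's conjecture (Khare–Wintenberger–Kisin) read in the
summit's automorphic L-normalisation: for every odd irreducible `σ̄ : Γ_ℚ → GL₂(k)`, every
`red : 𝒪_{ℚ̄_p} → k` and every `ι : ℚ̄_p ≃ ℂ`, an L-algebraic cuspidal `π₂` on `GL₂(𝔸_ℚ)` whose Satake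
polynomials `∏ (X - ι⁻¹(a_j⁻¹))` are `p`-integral and reduce through `red` to `charpoly σ̄(Frob_v)` a.e.
The Galois half (KW: a newform `f` and `ι_f : 𝓞_f → k`) is the in-tree named fact
`Literature.NumberTheory.Automorphic.khare_wintenberger` / `exists_newform_of_odd_irreducible`; what the
tree lacks is (B) the dictionary `newform ↦ L-algebraic cuspidal datum with inverse-Satake = Hecke roots`
— of which only the ARCHIMEDEAN half is missing — and (A) the alignment of KW's hidden `ι_f` with the
crux's `(ι, red)`.  The lever for (B): the adelic lift `φ_f = adelicLiftFunA N k f` is a LOWEST-WEIGHT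
VECTOR — it has `SO(2)`-weight `k` (`isWeightVec_adelicLiftFunA`), `Z φ_f = 0` (`lieDeriv_one_adelicLiftFunA`)
and is KILLED BY THE LOWERING OPERATOR along `ι_𝔸 : GL₂(ℝ) → GL₂(𝔸_ℚ)` (the Cauchy–Riemann equation of
`f` read in the group, Bump 1997 p. 274 (2.13); Stub 1) — so the `𝔰𝔩₂` identity
`X̄X = 2Ω + W² - 2iW` (`GL2Real.raiseFun_lowerFun`, proved) gives the Casimir scalar `(k-1)²/2 - ½`
WITHOUT any second-order computation, whence `φ_f ∈ 𝒜₀` (`Rat.isZFinite_of_casimir_of_zed`, proved) and,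
by cyclicity of the Borel–Jacquet datum it generates plus Harish-Chandra
(`GL2Casimir.hasHCParameter_of_lift_casimir_of_lift_zed`, proved), the archimedean parameter
`{(k-1)/2, (1-k)/2}` (Stub 2); the proved finite part (`heckeOperator_principalCongruenceLevel_adelicLiftFunA_one/two`,
`hasSatakeParamAt_of_eigenvector`) and the double twist `(ofDirichlet ε⁻¹ ⊗ |·|^{(k-1)/2}) ∘ det` then give
the L-algebraic datum with Satake parameter `{β₁⁻¹, β₂⁻¹}`, `β_j` the roots of `X² - a_q X + ε(q) q^{k-1}`
(Stub 3).  The lever for (A): decomposition-group transitivity realises ANY `j : 𝓞_K → k` as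
`red ∘ ι⁻¹ ∘ τ` for an embedding `τ : K → ℂ` (Stub 4, pure algebraic number theory), and the
`τ`-conjugate eigenpacket of a newform is a newform eigenpacket (Stub 5, Diamond–Shurman Thm. 6.5.4 from the
PROVED `Γ₁(N)` integral lattice `DeligneSerre1974_span_integralLattice1_holds` + `exists_isNewform1_of_eigenpacket`);
Stub 6 assembles (A) with Khare–Wintenberger into "Serre–KW with PRESCRIBED residual place `(ι, red)`",
which is the theorem as printed (KW-I p. 3: "We fix embeddings `ι_p : ℚ̄ ↪ ℚ̄_p` … arises from (with
respect to the fixed embedding `ι_p`) a newform").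

**Shape.** `SerreKWAutomorphicGL2_of : SerreKWAutomorphicGL2` (no hypotheses) is proved at the end of
this file from seven `stub_*` theorems; `sorry` occurs only inside the stubs; stub statements mention only
Mathlib, `Literature.*` and (verbatim) clauses of the route decl, so each can land as
`Theorems/SerreKWAutomorphicGL2<Stub>.lean` with `--supports stmt-Langlands-12944`.  Six stubs are proof
obligations PROVABLE NOW from landed theorems; the seventh, `stub_khareWintenberger`, is the tree's named
fact `khare_wintenberger p k` VERBATIM (the line's entire trust base, registered as a stub only because
the skeleton audit admits no named-fact hypothesis on `<Crux>_of`; nobody is asked to prove it — the lead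
closes the line "modulo KW" by turning it into the single hypothesis of the final theorem, the same shape
as the two sibling lines `adelic-newform-datum-double-twist` / `clozel-conjugation-alignment`, whose
registered `stub_khareWintenberger` has the identical signature).  The glue is sorry-free:
`serreWeakTwoLe_of_khareWintenberger` (strong KW ⟹ the weak form with Serre's bound `2 ≤ k(σ̄)`, by
`nonempty_localRestrictionAt`, `nonempty_ringHom_residue`, `ModPGaloisRep.two_le_serreWeightLocal_holds`,
all proved), `arithFrobPolyOfSatake_one_rootsInv` (the L-normalisation identity
`arithFrobPolyOfSatake ι q 1 {β⁻¹} = ∏ (X - ι⁻¹β)`, the `m = 1` twin of the tree's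
`arithFrobPolyOfSatake_heckeRoots`; card item P1, also proved by triager r1-1 in `W.lean`),
`isNormalized_ne_zero` (a newform is non-zero; copy of the tree's `IsNormalized.ne_zero`), and a
`filter_upwards` over the two cofinite sets.  (v1 of this skeleton, gen-1 planner 04:05Z, had six stubs
with KW consumed INSIDE Stub 6, which made Stub 6 unprovable as registered except conditionally; v2 moves
the fact out into its own registered stub so that every other registered signature is provable outright.)

* `stub_khareWintenberger` (K0; named-fact input, XL in print / 0 lines owed) — `∀ p k, khare_wintenberger p k`.

* `stub_loweringKillsLift` (K1; M) — `φ_f` is smooth in the archimedean variable of the datum and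
  `X φ_f = 0` along `ι_𝔸` (holomorphy).  Provable now.
* `stub_generatedDatum` (K2; L, HARDEST) — from Stub 1's two conclusions: `φ_f` generates a cuspidal
  Borel–Jacquet datum `π ∋ φ_f`, `φ_f ∉ W'`, of archimedean parameter `{(k-1)/2, (1-k)/2}`.  Provable now.
* `stub_dictionaryL` (K2'; M/L) — from such a `π` (newform `f`): an L-algebraic cuspidal `π₂` with
  `HasSatakeParamAt v {β₁⁻¹, β₂⁻¹}` for almost all `v` (finite part + double twist).  Provable now.
* `stub_residualEmbeddingAlignment` (K3a; M) — every `j : 𝓞_K → k` is `red ∘ ι⁻¹ ∘ τ` on `𝓞_K`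
  (`K ⊂ ℂ` a number field), with the `p`-integrality of `ι⁻¹ ∘ τ` on `𝓞_K` packaged as a ring map
  `θ : 𝓞_K → 𝒪_{ℚ̄_p}` (card items K3(a) + P2).  Provable now.
* `stub_conjugateNewformEigenpacket` (K3b; M/L) — Galois-conjugate eigenpackets of newforms are newform
  eigenpackets.  Provable now.
* `stub_serreKWPrescribedPlace` (K3 assembly; M) — weak KW (with `2 ≤ w`, the output of the glue
  `serreWeakTwoLe_of_khareWintenberger`) + Stubs 4 and 5 ⟹ Serre–KW with PRESCRIBED `(ι, red)`.  Provable
  now (pure bookkeeping over `IsGaloisRepOfNewform1Int`, `Polynomial.map_map`, finite exceptional sets).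

**Disproof used** (cdisprove cycle 1, 02:56Z, read by gen-1; CYCLE 2 = `Disproof.lean` v4, 2026-08-16T04:00Z,
tree commit 140bcbd64770, rc 0 / 0 sorry, re-read by gen-2 at this boundary): still NO
`_false_without_<H>` result (§2: neither `WithoutIsOdd` nor `WithoutIsIrreducible` is refutable), NO refuted
strengthening, NO tightness lemma, NO `-- Targets` (`payload.stuck_stubs = []`) and NO landed `Negative/` lemma — so there is
no obstruction of that form to honour by a named stub and nothing to import into the scratch check; this line
nevertheless USES `σ.IsOdd` and `σ.toGaloisRep.IsIrreducible`, each exactly once, at the KW step (the weak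
form fed to Stub 6 is produced from `stub_khareWintenberger` by `serreWeakTwoLe_of_khareWintenberger`),
consistent with §2 ("load-bearing for the printed proof, not for truth").  §1 `ResAutGL2.of_frobData`: every
stub touches `σ` only through `IsUnramifiedAt` / `HasFrobCharpolyAt` (i.e. through `σ^ss`), and
`serreKW_iff`/`ResAutGL2` is the shape `SerreKWAutomorphicGL2_of` proves.  §3 `red_factors_through_residue`
is the first step of Stub 4's proof; `finite_range` (new in v4) is not needed by any stub; `hcpt₂_inhabited`,
`iota_inhabited` show Stubs 2–3, 6 are not vacuous in `hcpt`/`ι`.  §4 (new in v4) "THE ONE NON-ABSORBABLE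
RISK" — a half-integral mismatch between the Tamagawa normalisation `q^{i(n-i)/2} e_i(α)` of `HasSatakeParamAt`
and the `ρ`-shifted Harish-Chandra parameter behind `IsLAlgebraic`, repairable by NO `∃ π₂` since only
`|det|^s` with `s ≡ (w-1)/2 (mod ℤ)` keeps `π_f ⊗ |det|^s` L-algebraic — is honoured EXACTLY and VISIBLY:
Stub 2 outputs the `ρ`-shifted parameter `{(k-1)/2, (1-k)/2}` through the PROVED
`GL2Casimir.hasHCParameter_of_lift_casimir_of_lift_zed` (its inputs `exists_hasHCParameter_of_hasCentralCharacter`,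
`nonempty_harishChandraHomGL_holds`, `harishChandraHomGL_unique_holds` are theorems, so the disprover's
"silently load-bearing" facts for the MEANING of `IsLAlgebraic` are discharged in the tree), Stub 3 starts
from the unitary pair the tree's operator identities give (`(√q)^{k-1}(α₁+α₂) = a_q`, `α₁α₂ = ε(q)`) and
twists by `s = (k-1)/2`, inside the admissible class, landing on exponents `{k-1, 0} =` the a-multiset of
`weightInfinityTypeGL2 ℚ k` ("`D_k ⊗ |det|^{(k-1)/2}`, the L-algebraic normalisation", proved
`isLAlgebraic_weightInfinityTypeGL2`); the disprover's weight-2 paper check (`(1/2,-1/2) ↦ (1,0)`,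
`α/ℓ^{1/2} ↦ α/ℓ`, inverses `ℓ/α = β ε(ℓ)⁻¹` integral) is the `k = 2`, `ε`-twisted instance of Stub 3's
pin, re-derived by all three triagers on `X₀(11)`, `q = 2`, `p = 3`.  The other §4 flips are discharged
explicitly: arithmetic Frobenius ↔ Satake inversion by the `ε⁻¹`-twist inside Stub 3 (NOT the unproved
contragredient fact `exists_contragredient_satake`, and NOT §5 (R0)'s dual-`σ` witness: with the
`ε⁻¹`-twist the arithmetic-Frobenius polynomial of `π₂` IS the Hecke polynomial, which
`IsGaloisRepOfNewform1Int` equates with `charpoly σ̄(arith Frob_q)`, so KW is applied to `σ̄` itself and no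
"dual of an odd irreducible is odd irreducible" lemma is owed), half-twist sign ↔ `{k-1, 0}` (a slip to
C-algebraic is caught by `IsCAlgebraic.not_isLAlgebraic_of_even` at `lean check` time), `(ι, red)` vs
`ι_f` ↔ Stubs 4–6.  §5 (new in v4): (R1) "CONJUGATION MISMATCH … the real gap behind the grounder's
`cuspidalAutomorphicRepData_of_newform`: the proof needs `f ↦ f^τ` or a KW fact with the residual place
prescribed — neither is in the tree" is PRECISELY lever (A) of this line: Stub 4 (the `τ`), Stub 5
(`f ↦ f^τ` from the proved `Γ₁(N)` integral lattice), Stub 6 (KW with prescribed place); (R2)'s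
normalisations (`red = φ ∘ residue`, finite image, oddness free at `p = 2`) are available to the provers of
Stubs 4 and 6 and change no statement.  Negatives index (`ledger negatives --problem Langlands`): 1 entry
(stmt-Langlands-3797, K3 Kuga–Satake anchor) — unrelated, no stub restates it.
-/

noncomputable section

open scoped MatrixGroups Classical
open NumberField IsDedekindDomain Filter Polynomial
open Literature.NumberTheory.Automorphic Literature.NumberTheory.EllipticCurves
  Literature.NumberTheory.EllipticCurves.ModularForms Literature.NumberTheory.GaloisRepresentations

namespace Summit.Langlands.Langlands.Cruxes.SerreKWAutomorphicGL2.LowestWeightCasimirDictionary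

set_option linter.dupNamespace false

/-! ## Stub 0 (K0) — the NAMED-FACT INPUT: the tree's `khare_wintenberger`, verbatim -/

/-- **Stub 0 (named-fact input, not a proof obligation): Serre's modularity conjecture, strong form, EXACTLY
as vendored in the tree** — `Literature.NumberTheory.Automorphic.khare_wintenberger p k`
(`= SerreModularityConjecture p k`: for `k` algebraically closed of characteristic `p`, every continuous,
irreducible, odd `σ̄ : Γ_ℚ → GL₂(k)` arises, along SOME `ι_f : 𝓞_f →+* k`, from a newform `f` of level
`N(σ̄)` and weight `k(σ̄)`: `IsGaloisRepOfNewform1Int f ι_f {q ∣ N(σ̄) p} σ̄`; Khare–Wintenberger (I)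
Thm. 1.2 + Thm. 9.1 with Hypothesis (H) = Kisin 2009), for all `p` and `k`.  It is the ONE unproved input
of the line (trust base `{khare_wintenberger}`, the minimum possible for a crux whose content IS KW — triage
r1-1/2/3), consumed only through the sorry-free re-indexing `serreWeakTwoLe_of_khareWintenberger` below, at
which `σ.IsOdd` and `σ.toGaloisRep.IsIrreducible` are used (Disproof §2) and nowhere else.  Registered as a
stub only because the skeleton audit admits no named-fact hypothesis on `SerreKWAutomorphicGL2_of`; NOBODY
is asked to prove it: the lead closes the line by deleting this stub and taking
`(hKW : ∀ p …, khare_wintenberger p k)` as the single hypothesis of the final theorem (`proof.conditional`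
on KW).  Same name and signature as the sibling lines' `stub_khareWintenberger`.  NOT the crux in a costume:
Galois side, classical newform, `∃ ι_f` INSIDE — the crux is automorphic, L-normalised, with `∀ red ∀ ι`
OUTSIDE (the gap between the two is exactly Stubs 1–6).  Size: named fact (XL in print; 0 lines owed here).
[cite: KhareWintenberger2009, Thm. 1.2 and Thm. 9.1] [cite: Kisin2009TwoAdic, Thm. 0.1, Cor. 0.2] -/
theorem stub_khareWintenberger :
    ∀ (p : ℕ) [Fact p.Prime] (k : Type) [Field k] [TopologicalSpace k] [DiscreteTopology k],
      khare_wintenberger p k := by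
  sorry

/-- **Serre's conjecture, weak form WITH the weight bound `2 ≤ w`, from `khare_wintenberger`** (sorry-free
re-indexing of Stub 0; this is the shape Stub 6 consumes).  For every prime `p`, every algebraically closed
discrete field `k` of characteristic `p` and every continuous, odd, irreducible `σ̄ : Γ_ℚ → GL₂(k)` there
are a level `N ≥ 1`, a weight `w ≥ 2`, a newform `f ∈ S_w(Γ₁(N))` and `ι_f : 𝓞_f →+* k` with `σ̄`
attached to `f` along `ι_f` away from `N p` (`IsGaloisRepOfNewform1Int`: unramified, and
`charpoly σ̄(Frob_q) = ι_f(P_q)`, `P_q ∈ 𝓞_f[X]` over the Hecke polynomial `X² - a_q(f) X + ε_f(q) q^{w-1}`).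
Proof: instantiate the strong form at a local restriction datum at `p` (`nonempty_localRestrictionAt`) and
a residue embedding (`nonempty_ringHom_residue`), take `N = N(σ̄)`, `w = k(σ̄)`, and use Serre's bound
`2 ≤ k(σ̄)` (`ModPGaloisRep.two_le_serreWeightLocal_holds`; Serre 1987, §2.4 Remarque) — cf. the tree's
`exists_newform_of_odd_irreducible_of_khare_wintenberger`, which forgets the bound.
[cite: KhareWintenberger2009, Thm. 1.2 and Thm. 9.1] [cite: Serre1987, §2.4 Remarque] -/
theorem serreWeakTwoLe_of_khareWintenberger
    (hKW : ∀ (p : ℕ) [Fact p.Prime] (k : Type) [Field k] [TopologicalSpace k] [DiscreteTopology k],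
      khare_wintenberger p k) :
    ∀ (p : ℕ) [Fact p.Prime] (k : Type) [Field k] [CharP k p] [IsAlgClosed k]
      [TopologicalSpace k] [DiscreteTopology k] (σ : FramedGaloisRep ℚ k 2),
      σ.IsOdd → σ.toGaloisRep.IsIrreducible →
        ∃ (N : ℕ) (_ : NeZero N) (w : ℤ) (_ : 2 ≤ w) (f : CuspForm (CongruenceSubgroup.Gamma1 N) w)
          (ιf : coeffCharIntegers f →+* k), IsNewform1 f ∧ IsGaloisRepOfNewform1Int f ιf {q | q ∣ N * p} σ := by
  intro p _ k _ _ _ _ _ σ hodd hirr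
  obtain ⟨loc⟩ := nonempty_localRestrictionAt (k := k) p σ
  obtain ⟨ιres⟩ := nonempty_ringHom_residue (k := k) p loc.F loc.residueFieldCard_eq
  obtain ⟨f, ιf, hf, hσf⟩ := hKW p k σ hirr hodd loc ιres
  have h2 : (2 : ℤ) ≤ (ModPGaloisRep.serreWeight p σ loc ιres : ℤ) := by
    exact_mod_cast ModPGaloisRep.two_le_serreWeightLocal_holds loc.rep ιres
  exact ⟨ModPGaloisRep.serreLevel p σ, _, _, h2, f, ιf, hf, hσf⟩

/-! ## Stub 1 (K1) — the lowering operator kills the adelic lift (Cauchy–Riemann in the group) -/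

/-- **Stub 1 (lowering kills the lift; smoothness in the archimedean variable).**  For every cusp form
`f ∈ S_k(Γ₁(N))` (any weight `k`, no eigen-assumption) the adelic lift `φ_f = adelicLiftFunA N k f` on
`GL₂(𝔸_ℚ)` is smooth in the archimedean variable of the automorphy datum `AutomorphyDatum.gl 2 ℚ hcpt`
(`X ↦ φ_f(g · exp X)` is `C^∞` on `𝔤 = 𝔤𝔩₂(ℚ_∞)`) and is annihilated by the lowering operator
`X = h - i(E₁₂ + E₂₁)` acting along `ι_𝔸 : GL₂(ℝ) → GL₂(𝔸_ℚ)` (`GL2Real.lowerFun Rat.iotaA`).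
Why true: at every adelic point `a`, `φ_f(a · ι_𝔸(x)) = archLift k f (h₀ x)` for `x ∈ GL₂(ℝ)⁺` with
`det h₀ > 0` (`exists_archSlice_adelicLiftFun`), the one-parameter subgroups of the datum are those of `ι_𝔸`
(`Rat.mul_ofArch_expMem_lieOfReal`, `det exp(tX) > 0`), `archLift k f (g) = f(g·i) j(g,i)^{-k} (det g)^{k/2}`
is real-smooth on `GL₂(ℝ)⁺` because `f` is holomorphic on `ℍ` (Mathlib `UpperHalfPlane.mdifferentiable` ⇒
analytic ⇒ `C^∞`) and the Möbius action, `j` and `det` are smooth; and on a smooth function of weight `k`,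
`(X F)(g_τ) = 0 ⟺ f_F` is complex-differentiable at `τ` (`GL2Real.mdifferentiableAt_archDescent_iff_lowering`,
`lowering_eq_of_hasArchWeight`, `archDescent_archLift`, all proved), i.e. the Cauchy–Riemann equation of `f`
(Bump 1997, p. 274, (2.13): "`L_k` annihilates `y^{k/2} f`"; Gelbart 1975, Prop. 3.1 (iv)–(v)).  Size M
(~300 lines: `ContDiff` of the slice through Mathlib's manifold/complex API; left-invariance of Lie
derivatives).  Convention check: in the tree's conventions (`IsWeightVec`, `k_θ = r(-θ)`, weight `+k` by
`isWeightVec_adelicLiftFunA`) the LOWEST weight vector is killed by `lowerFun`, as in the weight-one theory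
(`GL2Real.exists_isWeightVec_one_lowerFun_eq_zero`).
[cite: Bump1997, §3.2 (2.13) p. 274 and Exercise 2.1.7 (a)] [cite: Gelbart1975, Prop. 3.1 (iv)–(v), p. 28] -/
theorem stub_loweringKillsLift :
    ∀ (N : ℕ) [NeZero N] (k : ℤ) (f : CuspForm (CongruenceSubgroup.Gamma1 N) k)
      (hcpt : isCompact_glFiniteIntegralLevel 2 ℚ),
      IsArchSmooth (AutomorphyDatum.gl 2 ℚ hcpt).ofArch (adelicLiftFunA N k ⇑f) ∧
        GL2Real.lowerFun Rat.iotaA (adelicLiftFunA N k ⇑f) = 0 := by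
  sorry

/-! ## Stub 2 (K2) — the cuspidal datum generated by the lift and its archimedean parameter -/

/-- **Stub 2 (the generated datum; HARDEST).**  Let `f ∈ S_k(Γ₁(N))`, `k ≥ 2`, be non-zero and suppose
(Stub 1) that `φ_f = adelicLiftFunA N k f` is smooth in the archimedean variable and killed by the lowering
operator along `ι_𝔸`.  Then there is a cuspidal Borel–Jacquet datum `π = W / W'` of `GL₂(𝔸_ℚ)` with
`φ_f ∈ W ∖ W'` and archimedean (Harish-Chandra) parameter `{(k-1)/2, (1-k)/2}` — the parameter of the
discrete series `D_k` (Gelbart 1975, Lemma 5.16 (3) / Thm. 5.19; Bump 1997, Thm. 2.7.1).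
Why true / route (all bricks are theorems of the tree): (a) `φ_f ∈ 𝒜₀ = cuspFormsGL 2 ℚ hcpt`:
left `GL₂(ℚ)`-invariance (`adelicLiftFun_ofGlobal_mul`), level `K(N)`
(`adelicLiftFunA_mem_fixedPoints_principalCongruenceLevel`, `principalCongruenceLevel_mem_finiteLevelsGL_holds`),
archimedean smoothness (hypothesis), `K_∞`-finiteness (weight `k` along `ι_𝔸`, `isWeightVec_adelicLiftFunA`;
`K_∞ = O(2)` at the one real place, `maximalCompact_archGroupGL_eq`, `Rat.realToMixedGL_mem_maximalCompact`;
the `ε`-translate has weight `-k`, `IsWeightVec.archTranslate_epsK`), `Z(𝔤)`-finiteness from the two scalars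
`∑ E_{ab}E_{ba} φ_f = ((k-1)²/2 - ½) φ_f`, `Z φ_f = 0` (`Rat.isZFinite_of_casimir_of_zed`; the Casimir
scalar is FIRST ORDER: `GL2Real.raiseFun_lowerFun` with `X φ_f = 0`, `W φ_f = ik φ_f`
(`lieDeriv_rotGen_adelicLiftFunA`), `Z φ_f = 0` (`lieDeriv_one_adelicLiftFunA`) and
`GL2Real.casimirFun_add_half_zz`), moderate growth (bounded: `exists_bound_adelicLiftFun`), cusp condition
(`constantTermVanishes_adelicLift` through the discharged bridge `AutomorphicRepsGL.cuspConditionGL_invQuot_iff_holds`,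
`invQuot (adelicLift N k f) = φ_f` definitionally); (b) `π := CuspidalAutomorphicRepData.ofCuspForm hφ hφ0`
(`mem_W_ofCuspForm`, `not_mem_W'_ofCuspForm`; `φ_f ≠ 0` by `exists_adelicLiftFun_ne_zero`); (c) CENTRAL
CHARACTER BY CYCLICITY, no Schur (triage r1-2/3 sharpening): `S := {ψ ∈ 𝒜₀ : ∑E_{ab}E_{ba}ψ = cψ, Zψ = 0}` is
a `(𝔤, K_∞) × GL₂(𝔸_f)`-stable space containing `φ_f` (`C`, `Z` are central and `Ad`-invariant;
`lieDeriv_bracket_of_top`, `commute_ofArch`), so `W ≤ S` (`W_ofCuspForm_le`) and `Z(U𝔤) = ℝ[C, Z]`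
(`GL2Casimir.exists_character_lift_center_apply_eq_smul` / `lift_center_apply_eq_smul_of_casimir_of_zed`)
acts on `W / W'` through a character; (d) the Lie action on `W / W'` exists (`exists_hasLieAction_holds`),
`ρ(E_{ab})[ψ] = [E_{ab} ψ]` along `ι_𝔸` (`Rat.lieDeriv_ofArch_lieOfReal_eq`, `Rat.topEquiv_symm_realPlaceLie`,
as in `AutomorphicRepData.sum_lieDeriv_single_sub_smul_mem` read backwards), and
`GL2Casimir.hasHCParameter_of_sum_rho_single_of_rho_one` on the non-zero vector `[φ_f]` gives the parameter
(no regularity hypothesis, so no junk at small `k`).  Size L (~700 lines; the weight-one files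
`GL2AdelicWeightVectors`, `StrongArtinGL2WeightOneDictionary` are the same glue in the direction `π ↦ f`).
[cite: Gelbart1975, §3 Prop. 3.1 and §5 Lemma 5.16 (3), Thm. 5.19] [cite: Bump1997, Thm. 2.7.1 and §3.2, pp. 232–235, 274]
[cite: BorelJacquet1979, 4.2, 4.6] [cite: Knapp2002, Thm. 5.44 with Prop. 5.32] -/
theorem stub_generatedDatum :
    ∀ (N : ℕ) [NeZero N] (k : ℤ), 2 ≤ k → ∀ (f : CuspForm (CongruenceSubgroup.Gamma1 N) k), f ≠ 0 →
      ∀ (hcpt : isCompact_glFiniteIntegralLevel 2 ℚ),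
        IsArchSmooth (AutomorphyDatum.gl 2 ℚ hcpt).ofArch (adelicLiftFunA N k ⇑f) →
        GL2Real.lowerFun Rat.iotaA (adelicLiftFunA N k ⇑f) = 0 →
          ∃ π : CuspidalAutomorphicRepData 2 ℚ hcpt,
            adelicLiftFunA N k ⇑f ∈ π.1.W ∧ adelicLiftFunA N k ⇑f ∉ π.1.W' ∧
              π.1.HasArchParameter (fun _ => ({((k : ℂ) - 1) / 2, (1 - (k : ℂ)) / 2} : Multiset ℂ)) := by
  sorry

/-! ## Stub 3 (K2') — the L-normalised dictionary: finite part + double twist -/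

/-- **Stub 3 (the dictionary in the crux's L-normalisation).**  Let `f ∈ S_k(Γ₁(N))`, `k ≥ 2`, be a
newform and `π = W / W'` a cuspidal datum with `φ_f ∈ W ∖ W'` and archimedean parameter `{(k-1)/2, (1-k)/2}`
(Stub 2).  Then there is an L-ALGEBRAIC cuspidal datum `π₂` on `GL₂(𝔸_ℚ)` whose Satake parameter at almost
every finite place `v = q` is `{β₁⁻¹, β₂⁻¹}`, `β_{1,2}` the roots of the Hecke polynomial
`X² - a_q X + ε(q) q^{k-1}` of `f` (`ModularForms.heckePolynomial f q`, read in `ℂ[X]` by `map_heckePolynomial`).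
Why true: (i) at `v ∤ N`, `π` has Satake parameter `{α₁, α₂} = {q^{(1-k)/2} β₁, q^{(1-k)/2} β₂}`
(unitary normalisation): `φ_f` is `K(N)`-fixed (`adelicLiftFunA_mem_fixedPoints_principalCongruenceLevel`)
and `T_{v,1} φ_f = (√q)^{2-k} φ_{T_q f} = (√q)^{2-k} a_q φ_f`, `T_{v,2} φ_f = φ_{⟨q⟩ f} = ε(q) φ_f`
(`heckeOperator_principalCongruenceLevel_adelicLiftFunA_one/two`, `IsNewform1.heckeEigenvalue_eq_coeff_holds`,
`IsNewform1.mem_nebentypusSubspace_nebentypus_holds`; `T_{v,0} = 1` by `heckeOperator_apply_of_mem_center`),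
which are the eigenvalues `q^{i(2-i)/2} e_i(α)` of `AutomorphicRepData.hasSatakeParamAt_of_eigenvector`
(`φ_f ∈ W ∖ W'`, `Rat.valued_localUniformizer`); (ii) twist by the finite-order Hecke character
`HeckeCharacter.ofDirichlet ε⁻¹` (`CuspidalAutomorphicRepData.twist`,
`AutomorphicRepData.HasSatakeParamAt.twist_of_isUnramifiedAt`, `valueAtUniformizer_ofDirichlet : ψ_χ(ϖ_q) = χ(q)`):
Satake `{α_j ε(q)⁻¹} = {α₂⁻¹, α₁⁻¹}` since `α₁α₂ = ε(q)` — no Ramanujan, no contragredient fact —, archimedean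
parameter unchanged (`HasArchParameter.twist` pattern of `AutomorphicTwistWeightOne`); (iii) twist by
`|det|^{(k-1)/2}` (`CuspidalAutomorphicRepData.exists_twist_hasInfinityType`, proved for every real `s`): Satake
`× q^{-(k-1)/2}` gives `{(q^{(k-1)/2} α_j)⁻¹} = {β_j⁻¹}`, infinity type `+ (k-1)/2` gives exponents `{k-1, 0} ⊂ ℤ`,
i.e. `π₂` is L-algebraic (`weightInfinityTypeGL2 ℚ k`, `isLAlgebraic_weightInfinityTypeGL2`; the pre-twist
type `{((k-1)/2, (1-k)/2), ((1-k)/2, (k-1)/2)}` is well formed); (iv) the exceptional `v` (dividing `N` or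
the conductor) are finitely many.  Normalisation pin re-derived by all three triagers (X₀(11), `q = 2`,
`p = 3`: `X² + 2X + 2 ≡ X² - X - 1`).  Size M/L (~500 lines).
[cite: Gelbart1975, §3 Lemma 3.7 and Thm. 5.19] [cite: Bump1997, Thm. 3.6.1, pp. 340–342]
[cite: BuzzardGeeLMS2014, Def. 3.1.1 and §3.4] [cite: Clozel1990, §1.2, §3.3–3.5] -/
theorem stub_dictionaryL :
    ∀ (N : ℕ) [NeZero N] (k : ℤ), 2 ≤ k → ∀ (f : CuspForm (CongruenceSubgroup.Gamma1 N) k), IsNewform1 f →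
      ∀ (hcpt : isCompact_glFiniteIntegralLevel 2 ℚ) (π : CuspidalAutomorphicRepData 2 ℚ hcpt),
        adelicLiftFunA N k ⇑f ∈ π.1.W → adelicLiftFunA N k ⇑f ∉ π.1.W' →
        π.1.HasArchParameter (fun _ => ({((k : ℂ) - 1) / 2, (1 - (k : ℂ)) / 2} : Multiset ℂ)) →
          ∃ π₂ : CuspidalAutomorphicRepData 2 ℚ hcpt, π₂.1.IsLAlgebraic ∧
            ∀ᶠ v : HeightOneSpectrum (𝓞 ℚ) in cofinite,
              π₂.1.HasSatakeParamAt v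
                (((ModularForms.heckePolynomial f ((Rat.HeightOneSpectrum.primesEquiv v : Nat.Primes) : ℕ)).map
                    (algebraMap (coeffCharField f) ℂ)).roots.map (·⁻¹)) := by
  sorry

/-! ## Stub 4 (K3a) — alignment of the residual embedding (decomposition-group transitivity) -/

/-- **Stub 4 (residual-embedding alignment, with `p`-integrality).**  Let `k` be an algebraically closed
field of characteristic `p`, `red : 𝒪 = 𝒪_{ℚ̄_p} → k` a ring map, `ι : ℚ̄_p ≃ ℂ`, `K ⊂ ℂ` a number field
and `j : 𝓞_K → k` any ring map (`𝓞_K = integralClosure ℤ K`).  Then there are an embedding `τ : K → ℂ` and a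
ring map `θ : 𝓞_K → 𝒪` with `θ = ι⁻¹ ∘ τ` on `𝓞_K` (so `ι⁻¹(τ 𝓞_K) ⊂ 𝒪`: `p`-integrality transport, card
item P2 — integral over `ℤ` ⇒ valuation `≤ 1`) and `red ∘ θ = j`.  Why true: `red` is reduction modulo the
maximal ideal `𝔪` followed by an embedding `φ : 𝔽̄_p ↪ k` (`Disproof.red_factors_through_residue`);
`𝔭 := ker j` is a prime of `𝓞_K` over `p`; `𝔓₀ := (ι⁻¹)⁻¹(𝔪) ∩ ℤ̄` is a prime of `ℤ̄` over `p`; the Galois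
group of the Galois closure `L/ℚ` of `K` (or `Gal(ℚ̄/ℚ)`) is TRANSITIVE on the primes over `p`, so some
`τ = σ|_K` has `τ⁻¹(𝔓₀) ∩ 𝓞_K = 𝔭`; then `red ∘ ι⁻¹ ∘ τ` and `j` both factor through the finite field
`𝓞_K/𝔭` and differ by a power of Frobenius, which lifts to the decomposition group
(Mathlib `Ideal.Quotient.stabilizerHom_surjective`, or the profinite
`Ideal.Quotient.stabilizerHom_surjective_of_profinite` / `Algebra.IsInvariant.exists_smul_of_under_eq_of_profinite`
used in `IntegralGaloisActionProofs`; tree: `DeligneSerre1974.exists_ringHom_padicAlgCl_of_heightOneSpectrum`,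
`coeffCharIntegersMap`).  Verified true and non-vacuous by all three triagers (`exists_aut_align`,
`cardB_firstLemma`; toy `23a`, `K_f = ℚ(√5)`, `p = 3` inert).  Pure algebraic number theory over Mathlib;
size M (~350 lines, mostly coercions between `IntermediateField`, `integralClosure`, `Valued.integer`).
[cite: DiamondShurman2005, Thm. 6.5.4 (p. 260) with §9.6] [cite: KhareWintenberger2009, p. 3 ("we fix embeddings ι_p")] -/
theorem stub_residualEmbeddingAlignment :
    ∀ (p : ℕ) [Fact p.Prime] (k : Type) [Field k] [CharP k p] [IsAlgClosed k]
      (red : Valued.integer (PadicAlgCl p) →+* k) (ι : PadicAlgCl p ≃+* ℂ)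
      (K : IntermediateField ℚ ℂ) [FiniteDimensional ℚ K] (j : integralClosure ℤ K →+* k),
      ∃ (τ : K →+* ℂ) (θ : integralClosure ℤ K →+* Valued.integer (PadicAlgCl p)),
        (∀ x : integralClosure ℤ K,
          ((θ x : Valued.integer (PadicAlgCl p)) : PadicAlgCl p) = ι.symm (τ (x : K))) ∧
        ∀ x : integralClosure ℤ K, red (θ x) = j x := by
  sorry

/-! ## Stub 5 (K3b) — Galois-conjugate eigenpackets of newforms are newform eigenpackets -/

/-- **Stub 5 (conjugate newform eigenpacket; Diamond–Shurman Thm. 6.5.4).**  For a newform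
`f ∈ S_w(Γ₁(N))`, `w ≥ 2`, and any ring embedding `τ : K_f → ℂ` of its coefficient field
(`coeffCharField f = ℚ(a_n, ε(n))`, a number field by `finiteDimensional_coeffCharField` +
`IsNewform1.finiteDimensional_coeffField_of_span_integralLattice1` + `DeligneSerre1974_span_integralLattice1_holds`)
there is a newform `g` of the same weight and some level `M` whose Hecke polynomials at the primes
`q ∤ N M` are the `τ`-conjugates of those of `f`: `X² - a_q(g) X + ε_g(q) q^{w-1} = τ(X² - a_q(f) X + ε_f(q) q^{w-1})`
(in print `M = N` and all `q`).  Why true / route (triage r1-3 sharpening: argue on `q`-EXPANSIONS, the tree's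
lattice statement being the spanning half of Deligne–Serre (2.7.2)): `S_w(Γ₁(N))` is spanned over `ℂ` by the
lattice `L` of forms with integral `q`-expansion (`DeligneSerre1974_span_integralLattice1_holds N w`, PROVED for
all `N`, `w ≥ 1`), `L` is stable under `T_q` and `⟨d⟩` (`heckeT_mem_integralLattice1`, `diamondOp_mem_integralLattice1`),
relations among a `ℤ`-spanning family of `L` are cut out by integer linear equations on coefficients
(`q`-expansion injectivity), so `τ` applied coefficientwise to `f = ∑ c_i ℓ_i` (`c_i ∈ K_f`) is a cusp form
`f^τ ∈ S_w(Γ₁(N))` with `T_q f^τ = τ(a_q) f^τ` (`q ∤ N`) and `⟨d⟩ f^τ = τ(ε(d)) f^τ`; then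
`exists_isNewform1_of_eigenpacket` (PROVED: eigenpacket ⇒ newform `g` of level `M ∣ N` with `a_q(g) = τ(a_q(f))`,
`q ∤ N`, and nebentypus `τ ∘ ε_f` after `changeLevel`).  Size M/L (~500 lines).
[cite: DiamondShurman2005, Thm. 6.5.4 (p. 260) and Thm. 5.8.2] [cite: Shimura1971, Thm. 3.48 (p. 105) and (3.5.20)]
[cite: DeligneSerreASENS1974, (2.7.2)–(2.7.3)] -/
theorem stub_conjugateNewformEigenpacket :
    ∀ (N : ℕ) [NeZero N] (w : ℤ), 2 ≤ w → ∀ (f : CuspForm (CongruenceSubgroup.Gamma1 N) w), IsNewform1 f →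
      ∀ τ : coeffCharField f →+* ℂ,
        ∃ (M : ℕ) (_ : NeZero M) (g : CuspForm (CongruenceSubgroup.Gamma1 M) w), IsNewform1 g ∧
          ∀ q : ℕ, q.Prime → ¬ q ∣ N * M →
            (ModularForms.heckePolynomial g q).map (algebraMap (coeffCharField g) ℂ) =
              (ModularForms.heckePolynomial f q).map τ := by
  sorry

/-! ## Stub 6 (K3 assembly) — Serre–Khare–Wintenberger with prescribed residual place -/

/-- **Stub 6 (Serre–KW with PRESCRIBED `(ι, red)`, from weak KW and Stubs 4, 5; provable now).**
Hypotheses: the weak form of Serre's conjecture with the weight bound `2 ≤ w` (verbatim the conclusion of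
`serreWeakTwoLe_of_khareWintenberger`, which the glue feeds from Stub 0), and the statements of
`stub_residualEmbeddingAlignment` and `stub_conjugateNewformEigenpacket` (verbatim).  Conclusion: for every
prime `p`, `k` algebraically closed of characteristic `p` (discrete),
`red : 𝒪_{ℚ̄_p} → k`, every odd irreducible `σ̄ : Γ_ℚ → GL₂(k)` and every `ι : ℚ̄_p ≃ ℂ` there are a level
`N ≥ 1`, a weight `w ≥ 2` and a newform `g ∈ S_w(Γ₁(N))` such that for almost all `v`, `σ̄` is unramified at
`v` and the `ι⁻¹`-transport of `g`'s Hecke polynomial at `q_v` is a `p`-INTEGRAL polynomial `P ∈ 𝒪[X]` with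
`charpoly σ̄(Frob_v) = red(P)` — Serre's conjecture exactly as Khare–Wintenberger print it (KW-I, p. 3, with a
FIXED `ι_p : ℚ̄ ↪ ℚ̄_p`; card 5's transfer `SerreKWPrescribedPlace`).  Why true / route: the first hypothesis
at `(p, k, σ̄)` gives `N`, `w ≥ 2`, a newform `f ∈ S_w(Γ₁(N))` and `ι_f : 𝓞_f → k` with
`IsGaloisRepOfNewform1Int f ι_f {q ∣ N p} σ̄`: for `q_v ∤ N p`, `σ̄` is unramified at `v` and there is an
integral `P_f ∈ 𝓞_f[X]` over the Hecke polynomial with `σ̄.HasFrobCharpolyAt v (P_f.map ι_f)`; Stub 4 at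
`K := coeffCharField f` (a number field: `finiteDimensional_coeffCharField` with
`IsNewform1.finiteDimensional_coeffField_of_span_integralLattice1` + `DeligneSerre1974_span_integralLattice1_holds`),
`j := ι_f` (`coeffCharIntegers f` is `integralClosure ℤ (coeffCharField f)` by `rfl`) gives `τ`, `θ` with
`θ = ι⁻¹ ∘ τ`, `red ∘ θ = ι_f`; Stub 5 gives the conjugate newform `g` (level `M`); then for
`q_v ∤ N M p` put `P := P_f.map θ`: `P.map subtype = ((heckePolynomial f q).map τ).map ι⁻¹ =
((heckePolynomial g q).map (algebraMap _ ℂ)).map ι⁻¹` and `P.map red = P_f.map ι_f` (`Polynomial.map_map`);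
the exceptional set `{v : q_v ∣ N M p}` is finite (`∀ᶠ v in cofinite`, `Rat.HeightOneSpectrum.primesEquiv`).
Pure bookkeeping, no analysis and no named fact; size M (~250 lines, coercions `IntermediateField` /
`Subalgebra ℤ` / `Valued.integer`).  (v1 of the skeleton consumed KW inside this stub; v2 takes the weak
form as a hypothesis so that the registered signature is provable outright.)
[cite: KhareWintenberger2009, p. 3 ("we fix embeddings ι_p")] [cite: DeligneSerreASENS1974, §6]
[cite: DiamondShurman2005, Thm. 6.5.4 and Def. 9.6.4] -/
theorem stub_serreKWPrescribedPlace :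
    (∀ (p : ℕ) [Fact p.Prime] (k : Type) [Field k] [CharP k p] [IsAlgClosed k]
      [TopologicalSpace k] [DiscreteTopology k] (σ : FramedGaloisRep ℚ k 2),
      σ.IsOdd → σ.toGaloisRep.IsIrreducible →
        ∃ (N : ℕ) (_ : NeZero N) (w : ℤ) (_ : 2 ≤ w) (f : CuspForm (CongruenceSubgroup.Gamma1 N) w)
          (ιf : coeffCharIntegers f →+* k), IsNewform1 f ∧ IsGaloisRepOfNewform1Int f ιf {q | q ∣ N * p} σ) →
    (∀ (p : ℕ) [Fact p.Prime] (k : Type) [Field k] [CharP k p] [IsAlgClosed k]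
      (red : Valued.integer (PadicAlgCl p) →+* k) (ι : PadicAlgCl p ≃+* ℂ)
      (K : IntermediateField ℚ ℂ) [FiniteDimensional ℚ K] (j : integralClosure ℤ K →+* k),
      ∃ (τ : K →+* ℂ) (θ : integralClosure ℤ K →+* Valued.integer (PadicAlgCl p)),
        (∀ x : integralClosure ℤ K,
          ((θ x : Valued.integer (PadicAlgCl p)) : PadicAlgCl p) = ι.symm (τ (x : K))) ∧
        ∀ x : integralClosure ℤ K, red (θ x) = j x) →
    (∀ (N : ℕ) [NeZero N] (w : ℤ), 2 ≤ w → ∀ (f : CuspForm (CongruenceSubgroup.Gamma1 N) w), IsNewform1 f →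
      ∀ τ : coeffCharField f →+* ℂ,
        ∃ (M : ℕ) (_ : NeZero M) (g : CuspForm (CongruenceSubgroup.Gamma1 M) w), IsNewform1 g ∧
          ∀ q : ℕ, q.Prime → ¬ q ∣ N * M →
            (ModularForms.heckePolynomial g q).map (algebraMap (coeffCharField g) ℂ) =
              (ModularForms.heckePolynomial f q).map τ) →
    ∀ (p : ℕ) [Fact p.Prime] (k : Type) [Field k] [CharP k p] [IsAlgClosed k]
      [TopologicalSpace k] [DiscreteTopology k]
      (red : Valued.integer (PadicAlgCl p) →+* k) (σ : FramedGaloisRep ℚ k 2),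
      σ.IsOdd → σ.toGaloisRep.IsIrreducible → ∀ (ι : PadicAlgCl p ≃+* ℂ),
        ∃ (N : ℕ) (_ : NeZero N) (w : ℤ) (_ : 2 ≤ w) (g : CuspForm (CongruenceSubgroup.Gamma1 N) w),
          IsNewform1 g ∧
          ∀ᶠ v : HeightOneSpectrum (𝓞 ℚ) in cofinite,
            σ.IsUnramifiedAt v ∧
            ∃ P : Polynomial (Valued.integer (PadicAlgCl p)),
              P.map (Valued.integer (PadicAlgCl p)).subtype =
                ((ModularForms.heckePolynomial g ((Rat.HeightOneSpectrum.primesEquiv v : Nat.Primes) : ℕ)).map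
                  (algebraMap (coeffCharField g) ℂ)).map (ι.symm : ℂ →+* PadicAlgCl p) ∧
              σ.HasFrobCharpolyAt v (P.map red) := by
  sorry

/-! ## Glue (sorry-free) -/

section Helper

open Complex Filter Function
open UpperHalfPlane hiding I

/-- A normalised cusp form (`a₁ = 1`) is non-zero (the `q`-expansion of `0` vanishes) — copy of the tree's
`IsNormalized.ne_zero` (`ModularSymbolsLattice`), inlined to keep this skeleton's imports small. [folklore] -/
theorem isNormalized_ne_zero {Γ : Subgroup (GL (Fin 2) ℝ)} {k : ℤ} {f : CuspForm Γ k}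
    (h : IsNormalized f) : f ≠ 0 := by
  rintro rfl
  have hc : Periodic.cuspFunction 1 (0 : ℂ → ℂ) = 0 := by
    funext q
    by_cases hq : q = 0
    · subst hq
      exact Periodic.cuspFunction_zero_of_zero_at_inf one_pos (zero_zeroAtFilter _)
    · rw [Periodic.cuspFunction_eq_of_nonzero _ _ hq]
      rfl
  have h' : (qExpansion 1 (⇑(0 : CuspForm Γ k))).coeff 1 = 1 := h
  have h0 : (⇑(0 : CuspForm Γ k)) ∘ ofComplex = (0 : ℂ → ℂ) := by
    funext z
    simp
  rw [qExpansion_coeff, UpperHalfPlane.cuspFunction, h0, hc] at h'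
  simp at h'

end Helper

/-- **The L-normalisation identity** (card item P1; the `m = 1` twin of the tree's
`DeligneSerre1974.arithFrobPolyOfSatake_heckeRoots`, also proved by triager r1-1 in `W.lean`): for
`ι : ℚ̄_p ≃ ℂ`, any `q` and a monic `H ∈ ℂ[X]` (which splits), the Buzzard–Gee arithmetic-Frobenius polynomial
of the Satake parameter `{β⁻¹ : β ∈ roots H}` is `H` transported by `ι⁻¹`:
`arithFrobPolyOfSatake ι q 1 (H.roots.map (·⁻¹)) = ∏_β (X - ι⁻¹((β⁻¹)⁻¹)) = H.map ι⁻¹`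
(`arithFrobPolyOfSatake_one`, `inv_inv`, `Polynomial.prod_multiset_X_sub_C_of_monic_of_roots_card_eq`).
[cite: BuzzardGeeLMS2014, §2.1 and Conj. 3.2.1] -/
theorem arithFrobPolyOfSatake_one_rootsInv {p : ℕ} [Fact p.Prime] (ι : PadicAlgCl p ≃+* ℂ) (q : ℕ)
    {H : ℂ[X]} (hH : H.Monic) :
    arithFrobPolyOfSatake ι q 1 (H.roots.map (·⁻¹)) = H.map (ι.symm : ℂ →+* PadicAlgCl p) := by
  rw [arithFrobPolyOfSatake_one, Multiset.map_map]
  have hcard : Multiset.card H.roots = H.natDegree :=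
    Polynomial.splits_iff_card_roots.mp (IsAlgClosed.splits H)
  trans (H.roots.map fun β ↦ (X - C β).map (ι.symm : ℂ →+* PadicAlgCl p)).prod
  · congr 1
    refine Multiset.map_congr rfl fun β _ ↦ ?_
    simp only [Function.comp_apply, inv_inv, Polynomial.map_sub, Polynomial.map_X, Polynomial.map_C]
    rfl
  · conv_rhs => rw [← Polynomial.prod_multiset_X_sub_C_of_monic_of_roots_card_eq hH hcard]
    rw [Polynomial.map_multiset_prod, Multiset.map_map]
    rfl

/-- **The composition (kernel-checked, no `sorry` outside the stubs).**  `SerreKWAutomorphicGL2` from the seven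
stubs: fix `p, k, red, σ̄` odd irreducible, `hcpt₂, ι`.  Stub 6 (fed with the weak KW form
`serreWeakTwoLe_of_khareWintenberger stub_khareWintenberger` and with Stubs 4 and 5) gives a level `N`,
a weight `w ≥ 2`, a newform `g` and the cofinite set on which `σ̄` is unramified with
`charpoly σ̄(Frob_v) = red(P_v)`, `P_v ∈ 𝒪[X]` over `ι⁻¹(H_v(g))`; Stub 1 ⟶ Stub 2 (for `φ_g`, `g ≠ 0` by
`isNormalized_ne_zero`) ⟶ Stub 3 give an L-algebraic cuspidal `π₂` with `HasSatakeParamAt v {β₁⁻¹, β₂⁻¹}`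
on a cofinite set; on the intersection of the two cofinite sets take `a := {β_j⁻¹}`, `P := P_v`,
`Pb := P_v.map red`, and `arithFrobPolyOfSatake ι q_v 1 a = ι⁻¹(H_v(g)) = P_v.map subtype` by
`arithFrobPolyOfSatake_one_rootsInv` (`H_v(g)` monic: `monic_heckePolynomial`). -/
theorem SerreKWAutomorphicGL2_of :
    Summit.Langlands.Langlands.Theses.PhantomRMYoshida.SerreKWAutomorphicGL2 := by
  intro p _ k _ _ _ _ _ red σ hodd hirr hcpt₂ ι
  -- Galois side: Serre–KW with prescribed residual place `(ι, red)` (Stub 6 ← Stub 0 via the glue, Stubs 4, 5)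
  obtain ⟨N, hN, w, hw, g, hg, hG⟩ := stub_serreKWPrescribedPlace
    (serreWeakTwoLe_of_khareWintenberger stub_khareWintenberger) stub_residualEmbeddingAlignment
    stub_conjugateNewformEigenpacket p k red σ hodd hirr ι
  have hg0 : g ≠ 0 := isNormalized_ne_zero hg.2.2.2
  -- automorphic side: lowering kills `φ_g` (Stub 1), the generated datum (Stub 2), the dictionary (Stub 3)
  obtain ⟨hsm, hlow⟩ := stub_loweringKillsLift N w g hcpt₂
  obtain ⟨π, hW, hW', harch⟩ := stub_generatedDatum N w hw g hg0 hcpt₂ hsm hlow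
  obtain ⟨π₂, hL, hSat⟩ := stub_dictionaryL N w hw g hg hcpt₂ π hW hW' harch
  refine ⟨π₂, hL, ?_⟩
  -- bookkeeping on the intersection of the two cofinite sets
  filter_upwards [hSat, hG] with v hv hGv
  obtain ⟨hunr, P, hP, hchar⟩ := hGv
  refine ⟨_, P, P.map red, hv, ?_, hunr, hchar, rfl⟩
  rw [hP, arithFrobPolyOfSatake_one_rootsInv ι _ ((monic_heckePolynomial g _).map _)]

end Summit.Langlands.Langlands.Cruxes.SerreKWAutomorphicGL2.LowestWeightCasimirDictionary

end
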